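import Summits.ResolutionOfSingularities.ResolutionOfSingularities.Theorems.FrobeniusClosingPatchingRelPerfectConeDepthQuadricCharts
import Summits.ResolutionOfSingularities.ResolutionOfSingularities.Theorems.FrobeniusClosingPatchingRelPerfectConeDepthVertexFibre
import Summits.ResolutionOfSingularities.ResolutionOfSingularities.Theorems.FrobeniusClosingPatchingRelPerfectConeDepthLadderClimb
import HarnessLib

/-!
# Crux `PatchingRelPerfect` (stmt-ResolutionOfSingularities-16161), chain W5.2 — RUNG «r-quadric-ℓ» BY NAME: the NONDEGENERATE
# quadric at every exceptional depth, `(x₀x₁ + x₂x₃) + 𝔪^{ℓ+2} ∈ 𝒞` — the quadric fibre theorem, one blowing up, the END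

[OURS · L1 W5.2 · rung tool] Replaces the role of NO printed item; NOT a statement of the manuscript under review; fact-free,
any characteristic, any residue field.  AI-written (AI review is weaker than expert review).

`R` regular local with regular system of parameters `c₀, …, c₃` (`(c) = 𝔪`, `μ(𝔪) = 4`), `q = c₀c₁ + c₂c₃`.  On the chart `B_i`
of `Bl_𝔪 Spec R` (`e_j = c_j/c_i`, `e_i = 1`): `φ(q) = φ(c_i)² · f_i` with `f_i = e₀e₁ + e₂e₃` (`quadFun`, `chartBase_quad`), and
modulo the exceptional parameter `f_i ≡ T_k + T_lT_m` in `κ[T_j : j ≠ i]` (`{i, k} = {0, 1}` or `{2, 3}`), a GRAPH over the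
`T_k`-axis: at every prime `𝔓` over `𝔪` the members of `{φ(c_i), f_i}` lying in `𝔓` are part of one regular system of parameters
of `(B_i)_𝔓` (`quadChart`, from `isRsopPart_kill_hypersurface` with `∂/∂T_k = 1`), and `f_i ≠ φ(c_i)` (`quadFun_ne_chartBase`).
This is the whole local content of the rung «r-quadric-ℓ» `(c₀c₁ + c₂c₃) + 𝔪^{ℓ+2} ∈ 𝒞`: ONE blowing up of the closed point makes
the host smooth and transversal to the exceptional divisor everywhere, and the END of `…ConeDepthLadderClimb` applies at once.
-/

set_option linter.dupNamespace false

noncomputable section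

open CategoryTheory CategoryTheory.Limits AlgebraicGeometry TopologicalSpace IsLocalRing
open Literature.AlgebraicGeometry.Resolution
open Scheme.IdealSheafData
open scoped Pointwise

namespace Summit.ResolutionOfSingularities.ResolutionOfSingularities.Theorems

universe u

namespace ConeDepth

/-! ## The quadric fibre theorem: blowing up the vertex of the nondegenerate quadric host -/

section QuadricFibre

variable {X' X : Scheme.{u}} {σ : X' ⟶ X} {J : X.IdealSheafData}
  (hσ : IsBlowup σ J) (z : X) (c : Fin 4 → X.presheaf.stalk z) [IsRegularLocalRing (X.presheaf.stalk z)]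
  (hz𝔪 : Ideal.span (Set.range c) = maximalIdeal (X.presheaf.stalk z))
  (hd : (maximalIdeal (X.presheaf.stalk z)).spanFinrank = 4)
  (hJ : stalkIdeal J z = maximalIdeal (X.presheaf.stalk z)) (𝓗 : X.IdealSheafData)
  (h𝓗 : stalkIdeal 𝓗 z = Ideal.span {c 0 * c 1 + c 2 * c 3})
  (q : (j : Fin 4) → (Spec (.of (chartRing c j)) ⟶ X'))
  (hqσ : ∀ j, q j ≫ σ = Spec.map (CommRingCat.ofHom (chartBase c j)) ≫ X.fromSpecStalk z)
  (hqiso : ∀ j (w : Spec (.of (chartRing c j))), IsIso ((q j).stalkMap w))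

include hσ hz𝔪 hd hJ h𝓗 hqσ hqiso in
/-- **A point of the fibre on a graph chart**: if on chart `j` the quadric transform reads `f_j ≡ e_k + e_le_m`, then at every
point `x' = q_j(w)` over `z` the list `[σᶜ(𝓗,2), J𝒪_{X'}]` has simple normal crossings. [cite: Kollar2007, Def. 3.24] -/
theorem sncWithAt_quadChart (j k l m : Fin 4) (hkj : k ≠ j) (hlj : l ≠ j) (hmj : m ≠ j) (hkl : k ≠ l) (hkm : k ≠ m)
    (hquad : Ideal.Quotient.mk (Ideal.span {chartBase c j (c j)}) (quadFun c j) =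
      Ideal.Quotient.mk (Ideal.span {chartBase c j (c j)}) (chartGen c j k) +
        Ideal.Quotient.mk (Ideal.span {chartBase c j (c j)}) (chartGen c j l) *
          Ideal.Quotient.mk (Ideal.span {chartBase c j (c j)}) (chartGen c j m))
    (w : PrimeSpectrum (chartRing c j)) (x' : X') (hx' : q j w = x') (hz' : σ x' = z) :
    DepthSNC.SNCWithAt [controlledTransform σ J 𝓗 2, J.comap σ] ⊤ x' := by
  classical
  have hc := span_eq_stalkIdeal_centre z c hz𝔪 hJ
  haveI := hqiso j w
  obtain ⟨χ, hχ, hloc, hw𝔪⟩ := exists_stalk_presentation c j (q j) (hqσ j) w hx' hz'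
  letI : Algebra (chartRing c j) (X'.presheaf.stalk x') := χ.toAlgebra
  haveI := hloc
  have hnzd : χ (chartBase c j (c j)) ∈ nonZeroDivisors (X'.presheaf.stalk x') :=
    algebraMap_centre_mem_nonZeroDivisors c j (X'.presheaf.stalk x') (chartBase c j)
      (reesChartBase_mem_nonZeroDivisors (c j) (Ideal.mem_span_range_self (f := c) (x := j))) w.asIdeal
  have hstE : stalkIdeal (J.comap σ) x' = Ideal.span {χ (chartBase c j (c j))} :=
    stalkIdeal_exceptional_of_presentation χ hz' hχ hc
  have hstH : stalkIdeal (controlledTransform σ J 𝓗 2) x' = Ideal.span {χ (quadFun c j)} :=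
    stalkIdeal_controlledTransform_of_presentation χ hz' hχ hσ hc hnzd 𝓗 _ h𝓗 2 (quadFun c j)
      (by rw [chartBase_quad c j, map_mul, map_pow])
  have hne := quadFun_ne_chartBase c hz𝔪 hd j k l m hkj hlj hmj hkl hquad
  have key : DepthSNC.SNCWithAt ([(J.comap σ, chartBase c j (c j)), (controlledTransform σ J 𝓗 2, quadFun c j)].map Prod.fst)
      ⊤ x' := by
    refine sncWithAt_of_adapted χ w.asIdeal hloc _ ?_ ?_ ?_
    · intro p hp
      simp only [List.mem_cons, List.not_mem_nil, or_false] at hp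
      rcases hp with rfl | rfl
      · exact hstE
      · exact hstH
    · intro p hp p' hp' h
      simp only [List.mem_cons, List.not_mem_nil, or_false] at hp hp'
      rcases hp with rfl | rfl <;> rcases hp' with rfl | rfl
      · rfl
      · exact absurd h.symm hne
      · exact absurd h hne
      · rfl
    · exact quadChart c hz𝔪 hd j w.asIdeal hw𝔪 (X'.presheaf.stalk x') k l m hkj hlj hmj hkl hkm hquad
  refine key.anti fun D hD _ => ?_
  simp only [List.mem_cons, List.not_mem_nil, or_false] at hD
  simp only [List.map_cons, List.map_nil, List.mem_cons, List.not_mem_nil, or_false]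
  rcases hD with rfl | rfl
  · exact Or.inr rfl
  · exact Or.inl rfl

end QuadricFibre

/-- **THE QUADRIC FIBRE THEOREM.**  Blow up a point `z` of a scheme `X` (`σ` a blowing up along `J` with `J_z = 𝔪_z`) where
`𝒪_{X,z}` is regular of dimension `4` with regular system of parameters `c`, and follow the NONDEGENERATE quadric host
`𝓗_z = (c₀c₁ + c₂c₃)`: at EVERY point over `z` the weight-`2` controlled transform of `𝓗` and the exceptional divisor have simple
normal crossings (no new vertex: the projectivised tangent cone is a smooth quadric surface). [cite: Kollar2007, 3.61]
[cite: StacksProject, Tag 0804] -/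
theorem quadric_fibre {X' X : Scheme.{u}} {σ : X' ⟶ X} {J : X.IdealSheafData} (hσ : IsBlowup σ J) (z : X)
    (c : Fin 4 → X.presheaf.stalk z) [IsRegularLocalRing (X.presheaf.stalk z)]
    (hz𝔪 : Ideal.span (Set.range c) = maximalIdeal (X.presheaf.stalk z))
    (hd : (maximalIdeal (X.presheaf.stalk z)).spanFinrank = 4)
    (hJ : stalkIdeal J z = maximalIdeal (X.presheaf.stalk z)) (𝓗 : X.IdealSheafData)
    (h𝓗 : stalkIdeal 𝓗 z = Ideal.span {c 0 * c 1 + c 2 * c 3}) :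
    ∀ x' : X', σ x' = z → DepthSNC.SNCWithAt [controlledTransform σ J 𝓗 2, J.comap σ] ⊤ x' := by
  classical
  obtain ⟨q, hqσ, hqiso, hcov⟩ := exists_charts_over hσ z c (span_eq_stalkIdeal_centre z c hz𝔪 hJ)
  intro x' hx'
  obtain ⟨j, w, hqw⟩ := hcov x' hx'
  fin_cases j
  · exact sncWithAt_quadChart hσ z c hz𝔪 hd hJ 𝓗 h𝓗 q hqσ hqiso 0 1 2 3 (by decide) (by decide) (by decide) (by decide)
      (by decide) (mk_quadFun_zero c) w x' hqw hx'
  · exact sncWithAt_quadChart hσ z c hz𝔪 hd hJ 𝓗 h𝓗 q hqσ hqiso 1 0 2 3 (by decide) (by decide) (by decide) (by decide)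
      (by decide) (mk_quadFun_one c) w x' hqw hx'
  · exact sncWithAt_quadChart hσ z c hz𝔪 hd hJ 𝓗 h𝓗 q hqσ hqiso 2 3 0 1 (by decide) (by decide) (by decide) (by decide)
      (by decide) (mk_quadFun_two c) w x' hqw hx'
  · exact sncWithAt_quadChart hσ z c hz𝔪 hd hJ 𝓗 h𝓗 q hqσ hqiso 3 2 0 1 (by decide) (by decide) (by decide) (by decide)
      (by decide) (mk_quadFun_three c) w x' hqw hx'

/-! ## The rung «r-quadric-ℓ»: one blowing up of the closed point, then the END -/

section QuadricRung

variable {S : Type u} [CommRing S] [IsRegularLocalRing S]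
  (x : Fin 4 → S) (hx : Ideal.span (Set.range x) = maximalIdeal S) (hdim : ringKrullDim S = (4 : ℕ)) (ℓ : ℕ)

omit [IsRegularLocalRing S] in
/-- The stalk of `𝔪~` at the closed point of `Spec S` is the maximal ideal of `𝒪_{Spec S, 𝔪}`. [cite: Hartshorne1977, II Prop. 5.1 (b)] -/
theorem stalkIdeal_idealSheaf_maximalIdeal_closedPoint [IsLocalRing S] :
    stalkIdeal (affineBlowup.idealSheaf (maximalIdeal S)) (IsLocalRing.closedPoint S : Spec (.of S)) =
      maximalIdeal ((Spec (.of S)).presheaf.stalk (IsLocalRing.closedPoint S : Spec (.of S))) := by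
  letI : Algebra S ((Spec (.of S)).presheaf.stalk (IsLocalRing.closedPoint S : Spec (.of S))) :=
    inferInstanceAs (Algebra S ((Spec.structureSheaf S).presheaf.stalk (IsLocalRing.closedPoint S)))
  haveI : IsLocalization.AtPrime ((Spec (.of S)).presheaf.stalk (IsLocalRing.closedPoint S : Spec (.of S))) (maximalIdeal S) :=
    inferInstanceAs (IsLocalization.AtPrime ((Spec.structureSheaf S).presheaf.stalk (IsLocalRing.closedPoint S))
      (IsLocalRing.closedPoint S).asIdeal)
  rw [DepthTargets.stalkIdeal_idealSheaf_eq,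
    ← IsLocalization.AtPrime.map_eq_maximalIdeal (maximalIdeal S) ((Spec (.of S)).presheaf.stalk (IsLocalRing.closedPoint S))]
  rfl

include hx hdim in
/-- **Simple normal crossings on the first blowing up**: on `X₁ = Bl_𝔪 Spec S` the strict transform `𝓗₁ = σ₁ᶜ((q)~, 2)` of the
nondegenerate quadric `q = x₀x₁ + x₂x₃` and the exceptional divisor have simple normal crossings at every point over the closed
point (`quadric_fibre` at the closed point of `Spec S`, `𝒪_{Spec S, 𝔪} = S_𝔪`). [cite: Kollar2007, 3.61] [cite: Hartshorne1977, II Prop. 5.1 (b)] -/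
theorem quadric_sncWithAt_blowup :
    ∀ y : blowup (affineBlowup.idealSheaf (maximalIdeal S)),
      blowup.π (affineBlowup.idealSheaf (maximalIdeal S)) y = IsLocalRing.closedPoint S →
    DepthSNC.SNCWithAt
      [controlledTransform (blowup.π (affineBlowup.idealSheaf (maximalIdeal S))) (affineBlowup.idealSheaf (maximalIdeal S))
          (affineBlowup.idealSheaf (Ideal.span {x 0 * x 1 + x 2 * x 3})) 2,
        (affineBlowup.idealSheaf (maximalIdeal S)).comap (blowup.π (affineBlowup.idealSheaf (maximalIdeal S)))] ⊤ y := by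
  classical
  haveI : IsRegularRing S := isRegularRing_of_isRegularLocalRing S
  set J₀ : (Spec (.of S)).IdealSheafData := affineBlowup.idealSheaf (maximalIdeal S) with hJ₀
  have hσ : IsBlowup (blowup.π J₀) J₀ := blowup.isBlowup J₀
  let z₀ : Spec (.of S) := IsLocalRing.closedPoint S
  letI : Algebra S ((Spec (.of S)).presheaf.stalk z₀) :=
    inferInstanceAs (Algebra S ((Spec.structureSheaf S).presheaf.stalk z₀))
  haveI : IsLocalization.AtPrime ((Spec (.of S)).presheaf.stalk z₀) (maximalIdeal S) :=
    inferInstanceAs (IsLocalization.AtPrime ((Spec.structureSheaf S).presheaf.stalk z₀) z₀.asIdeal)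
  haveI hregA : IsRegularLocalRing ((Spec (.of S)).presheaf.stalk z₀) := Scheme.isRegular_Spec (.of S) z₀
  have hmaxA : maximalIdeal ((Spec (.of S)).presheaf.stalk z₀) =
      (maximalIdeal S).map (algebraMap S ((Spec (.of S)).presheaf.stalk z₀)) :=
    (IsLocalization.AtPrime.map_eq_maximalIdeal (maximalIdeal S) _).symm
  have hdimA : ringKrullDim ((Spec (.of S)).presheaf.stalk z₀) = (4 : ℕ) := by
    rw [IsLocalization.AtPrime.ringKrullDim_eq_height (maximalIdeal S) ((Spec (.of S)).presheaf.stalk z₀),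
      IsLocalRing.maximalIdeal_height_eq_ringKrullDim, hdim]
  have hdA : (maximalIdeal ((Spec (.of S)).presheaf.stalk z₀)).spanFinrank = 4 := by
    have h := IsRegularLocalRing.spanFinrank_maximalIdeal (R := (Spec (.of S)).presheaf.stalk z₀)
    rw [hdimA] at h
    exact_mod_cast h
  let c : Fin 4 → (Spec (.of S)).presheaf.stalk z₀ := fun i => algebraMap S _ (x i)
  have hc : Ideal.span (Set.range c) = maximalIdeal ((Spec (.of S)).presheaf.stalk z₀) := by
    rw [show Set.range c = algebraMap S ((Spec (.of S)).presheaf.stalk z₀) '' Set.range x from (Set.range_comp _ x),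
      ← Ideal.map_span, hx, hmaxA]
  have hJ : stalkIdeal J₀ z₀ = maximalIdeal ((Spec (.of S)).presheaf.stalk z₀) :=
    stalkIdeal_idealSheaf_maximalIdeal_closedPoint
  have hH₀ : stalkIdeal (affineBlowup.idealSheaf (Ideal.span {x 0 * x 1 + x 2 * x 3})) z₀ =
      Ideal.span {c 0 * c 1 + c 2 * c 3} := by
    rw [DepthTargets.stalkIdeal_idealSheaf_eq, Ideal.map_span, Set.image_singleton, map_add, map_mul, map_mul]
    rfl
  intro y hy
  exact quadric_fibre hσ z₀ c hc hdA hJ _ hH₀ y hy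

include hx in
/-- **The format on the first blowing up**: `I𝒪_{X₁} = 𝓘_{E₁}² · ((𝓗₁,1)(E₁,0) ⊔ (𝓗₁,0)(E₁,ℓ))` for `I = (q) + 𝔪^{ℓ+2}`.
[cite: BierstoneGrigorievMilmanWlodarczyk2011, §3.2 Lemma 3.2.1] -/
theorem quadric_format {X₁ : Scheme.{u}} {σ : X₁ ⟶ Spec (.of S)}
    (hσ : IsBlowup σ (affineBlowup.idealSheaf (maximalIdeal S))) :
    (affineBlowup.idealSheaf (Ideal.span {x 0 * x 1 + x 2 * x 3} ⊔ maximalIdeal S ^ (ℓ + 2))).comap σ =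
      (affineBlowup.idealSheaf (maximalIdeal S)).comap σ ^ 2 *
        (monomialIdeal [(controlledTransform σ (affineBlowup.idealSheaf (maximalIdeal S))
            (affineBlowup.idealSheaf (Ideal.span {x 0 * x 1 + x 2 * x 3})) 2, 1),
            ((affineBlowup.idealSheaf (maximalIdeal S)).comap σ, 0)] ⊔
          monomialIdeal [(controlledTransform σ (affineBlowup.idealSheaf (maximalIdeal S))
            (affineBlowup.idealSheaf (Ideal.span {x 0 * x 1 + x 2 * x 3})) 2, 0),
            ((affineBlowup.idealSheaf (maximalIdeal S)).comap σ, ℓ)]) := by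
  have hH : (affineBlowup.idealSheaf (maximalIdeal S)).comap σ ^ 2 *
      controlledTransform σ (affineBlowup.idealSheaf (maximalIdeal S))
        (affineBlowup.idealSheaf (Ideal.span {x 0 * x 1 + x 2 * x 3})) 2 =
      (affineBlowup.idealSheaf (Ideal.span {x 0 * x 1 + x 2 * x 3})).comap σ := by
    haveI : IsProper σ := hσ.isProper
    haveI : IsLocallyNoetherian X₁ := LocallyOfFiniteType.isLocallyNoetherian σ
    refine pow_mul_controlledTransform_eq σ _ hσ.isEffectiveCartier ?_
    rw [← comap_pow]
    refine Scheme.IdealSheafData.comap_mono σ ?_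
    rw [← DepthOne.idealSheaf_pow]
    refine idealSheaf_mono ?_
    rw [Ideal.span_singleton_le_iff_mem, ← hx, pow_two]
    have hm : ∀ i, x i ∈ Ideal.span (Set.range x) := fun i => Ideal.subset_span ⟨i, rfl⟩
    exact Ideal.add_mem _ (Ideal.mul_mem_mul (hm 0) (hm 1)) (Ideal.mul_mem_mul (hm 2) (hm 3))
  rw [DepthTargets.idealSheaf_sup_eq, DepthOne.idealSheaf_pow, Scheme.IdealSheafData.comap_sup, comap_pow, ← hH]
  simp only [monomialIdeal_cons, monomialIdeal_nil, pow_one, pow_zero, Scheme.IdealSheafData.one_eq_top,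
    Scheme.IdealSheafData.mul_top, Scheme.IdealSheafData.top_mul]
  rw [← Scheme.IdealSheafData.add_eq_sup, ← Scheme.IdealSheafData.add_eq_sup]
  ring

include hx hdim in
/-- **RUNG «r-quadric-ℓ», UNCONDITIONAL PACKAGE**: for `S` regular local of dimension `4`, `x` spanning `𝔪`, the NONDEGENERATE
quadric `q = x₀x₁ + x₂x₃` and EVERY `ℓ`: (1) `(q) + 𝔪^{ℓ+2} ∈ 𝒞` (an `𝔪`-primary companion with a regular blowing up);
(2) the blow-up-form core conclusion for every `T = Bl_I Spec S`, `I = (q) + 𝔪^{ℓ+2}`.  One blowing up of the closed point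
(`quadric_format`, `quadric_sncWithAt_blowup`), then the END `coneEndCompanion`.  Every characteristic, every residue field, no
completeness, fact-free. [cite: Kollar2007, 3.61 and (3.111) Step 3] [cite: StacksProject, Tag 080A] -/
theorem quadricRung_of_ringKrullDim :
    (∃ (Q : Ideal S) (m : ℕ), IsLocalRing.maximalIdeal S ^ m ≤ Q ∧
      ∃ (B' : Scheme.{u}) (b : B' ⟶ Spec (.of S)),
        IsBlowup b (affineBlowup.idealSheaf ((Ideal.span {x 0 * x 1 + x 2 * x 3} ⊔ maximalIdeal S ^ (ℓ + 2)) * Q)) ∧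
        Scheme.IsRegular B') ∧
    (∀ (T : Scheme.{u}) (f : T ⟶ Spec (.of S)),
      IsBlowup f (affineBlowup.idealSheaf (Ideal.span {x 0 * x 1 + x 2 * x 3} ⊔ maximalIdeal S ^ (ℓ + 2))) →
      ∃ (J : T.IdealSheafData) (T' : Scheme.{u}) (π : T' ⟶ T), J ≠ ⊥ ∧
        (∀ t : T, t ∈ J.support → f.base t = IsLocalRing.closedPoint S) ∧
        IsBlowup π J ∧ Scheme.IsRegular T') := by
  classical
  have hd : (maximalIdeal S).spanFinrank = 4 := by
    have h := IsRegularLocalRing.spanFinrank_maximalIdeal (R := S)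
    rw [hdim] at h
    exact_mod_cast h
  haveI : IsDomain S := isDomain_of_isRegularLocalRing S
  haveI : IsRegularRing S := isRegularRing_of_isRegularLocalRing S
  have h𝔪 : maximalIdeal S ≠ ⊥ := by
    intro h
    rw [h, Submodule.spanFinrank_bot] at hd
    exact absurd hd (by norm_num)
  have hI : Ideal.span {x 0 * x 1 + x 2 * x 3} ⊔ maximalIdeal S ^ (ℓ + 2) ≠ ⊥ := fun h =>
    pow_ne_zero (ℓ + 2) h𝔪 (eq_bot_iff.mpr (le_sup_right.trans h.le))
  have hIm : ((affineBlowup.idealSheaf (Ideal.span {x 0 * x 1 + x 2 * x 3} ⊔ maximalIdeal S ^ (ℓ + 2))).support :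
      Set (Spec (.of S))) ⊆ {IsLocalRing.closedPoint S} := fun s hs =>
    Set.mem_singleton_iff.mpr (support_idealSheaf_subset_closedPoint (n := ℓ + 2) le_sup_right s hs)
  set J₀ : (Spec (.of S)).IdealSheafData := affineBlowup.idealSheaf (maximalIdeal S) with hJ₀
  have hσ : IsBlowup (blowup.π J₀) J₀ := blowup.isBlowup J₀
  haveI : IsProper (blowup.π J₀) := hσ.isProper
  haveI : IsLocallyNoetherian (blowup J₀) := LocallyOfFiniteType.isLocallyNoetherian (blowup.π J₀)
  haveI : IsNoetherian (blowup J₀) := by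
    haveI : CompactSpace (blowup J₀) := QuasiCompact.compactSpace_of_compactSpace (blowup.π J₀)
    exact {}
  have hsuppJ₀ : ∀ s : Spec (.of S), s ∈ J₀.support → s = IsLocalRing.closedPoint S := fun s hs =>
    support_idealSheaf_subset_closedPoint (Q := maximalIdeal S) (n := 1) (by rw [pow_one]) s hs
  -- regularity of `X₁`: the centre `V(𝔪~)` is the reduced closed point
  have hreg : Scheme.IsRegular (blowup J₀) := by
    refine IsBlowup.isRegular_of_isRegular_subscheme (Scheme.isRegular_Spec (.of S)) ?_ hσ
    refine Scheme.isRegular_subscheme_of_forall J₀ fun y hy => ?_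
    obtain rfl : y = IsLocalRing.closedPoint S := hsuppJ₀ y hy
    have hJ : stalkIdeal J₀ (IsLocalRing.closedPoint S : Spec (.of S)) = maximalIdeal _ :=
      stalkIdeal_idealSheaf_maximalIdeal_closedPoint
    rw [hJ]
    letI := Ideal.Quotient.field (maximalIdeal ((Spec (.of S)).presheaf.stalk (IsLocalRing.closedPoint S)))
    infer_instance
  have hfmt := quadric_format x hx ℓ hσ
  -- the two exponent lists on the boundary `[𝓗₁, E₁]`
  set H₁ : (blowup J₀).IdealSheafData :=
    controlledTransform (blowup.π J₀) J₀ (affineBlowup.idealSheaf (Ideal.span {x 0 * x 1 + x 2 * x 3})) 2 with hH₁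
  set E₁ : (blowup J₀).IdealSheafData := J₀.comap (blowup.π J₀) with hE₁
  have hAB : boundaryOf [(H₁, 1), (E₁, 0)] = boundaryOf [(H₁, 0), (E₁, ℓ)] := rfl
  have hover : ∀ y : blowup J₀, y ∈ (monomialIdeal [(H₁, 1), (E₁, 0)] ⊔ monomialIdeal [(H₁, 0), (E₁, ℓ)]).support →
      blowup.π J₀ y = IsLocalRing.closedPoint S := by
    intro y hy
    have hyI : y ∈ ((affineBlowup.idealSheaf (Ideal.span {x 0 * x 1 + x 2 * x 3} ⊔ maximalIdeal S ^ (ℓ + 2))).comap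
        (blowup.π J₀)).support := by
      rw [hfmt, Scheme.IdealSheafData.support_mul]
      exact Or.inr hy
    rw [Scheme.IdealSheafData.support_comap] at hyI
    exact hIm hyI
  have hsnc : ∀ y : blowup J₀, y ∈ (monomialIdeal [(H₁, 1), (E₁, 0)] ⊔ monomialIdeal [(H₁, 0), (E₁, ℓ)]).support →
      DepthSNC.SNCWithAt (boundaryOf [(H₁, 1), (E₁, 0)]) ⊤ y := fun y hy =>
    quadric_sncWithAt_blowup x hx hdim y (hover y hy)
  have hC := coneEndCompanion hI hreg ⟨J₀, hσ, fun s hs => Set.mem_singleton_iff.mpr (hsuppJ₀ s hs)⟩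
    (hσ.isEffectiveCartier.isLocallyPrincipal.pow 2) [(H₁, 1), (E₁, 0)] [(H₁, 0), (E₁, ℓ)] hAB hsnc hover hfmt
  exact ⟨hC, fun T f hf => atomConclusion_of_companion' hI hC T f hf⟩

end QuadricRung

/-- **The registered core's binder shape on the member `(x₀x₁ + x₂x₃) + 𝔪^{ℓ+2}`** (hypotheses of `stub_atomDimFourBlowup`;
characteristic, completeness, residue field and the off-fibre hypothesis unused). [cite: Kollar2007, 3.61] -/
theorem atomDimFourBlowupAt_quadric_sup_pow (p : ℕ) (_hp : p.Prime) (S : Type) [CommRing S]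
    [IsRegularLocalRing S] [CharP S p] [IsAdicComplete (IsLocalRing.maximalIdeal S) S]
    [PerfectField (IsLocalRing.ResidueField S)] (hS : ringKrullDim S = (4 : ℕ))
    (x : Fin 4 → S) (hx : Ideal.span (Set.range x) = IsLocalRing.maximalIdeal S) (ℓ : ℕ)
    (T : Scheme.{0}) (f : T ⟶ Spec (.of S))
    (hf : IsBlowup f (affineBlowup.idealSheaf (Ideal.span {x 0 * x 1 + x 2 * x 3} ⊔ IsLocalRing.maximalIdeal S ^ (ℓ + 2))))
    (_hoff : ∀ t : T, f.base t ≠ IsLocalRing.closedPoint S → IsRegularLocalRing (T.presheaf.stalk t)) :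
    ∃ (J : T.IdealSheafData) (T' : Scheme.{0}) (π : T' ⟶ T), J ≠ ⊥ ∧
      (∀ t : T, t ∈ J.support → f.base t = IsLocalRing.closedPoint S) ∧
      IsBlowup π J ∧ Scheme.IsRegular T' :=
  (quadricRung_of_ringKrullDim x hx hS ℓ).2 T f hf

end ConeDepth

end Summit.ResolutionOfSingularities.ResolutionOfSingularities.Theorems

end
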